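import Literature.Probability.Percolation.CharLengthComparison
import Literature.Probability.Percolation.NearCriticalScalingProofs
import Literature.Probability.Percolation.KestenScalingThetaProofs
import HarnessLib

/-!
# Nolin's Lemma 39 for every `ε ∈ (0, 1/2)`: the leaves, and Werner's route without RSW at general `p`

Topic `Literature/Probability/Percolation`; family `crit-perc`. Proof-only sibling of
`NearCriticalArm.lean` for its named fact `Nolin2008_lemma39` — the uniform exponential decay of
easy-way crossings above the characteristic length, `P_p(𝒞_H([0, n] × [0, k n])) ≤ C₁ e^{-C₂ n / L_ε(p)}`
for `ε < p < 1/2`, EVERY `ε ∈ (0, 1/2)` (Nolin 2008, §7.4, Lemma 39 with Remark 40; EJP numbering,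
= Lemma 37 / Remark 38 of arXiv 0711.4948) — no new definition, no new named fact.

## The printed proof and the state of the tree

Nolin (arXiv p. 26): the block argument proves the lemma "for any `ε` below some fixed value `ε₀`
(given by RSW). The result for any `ε ∈ (0, 1/2)` follows readily by using the equivalence of
lengths for different values of `ε` (Corollary 35)" [EJP: Cor. 37]. In the tree:

* the block argument is a theorem twice over: above Nolin's `L_ε(p)` for `ε ≤ ε₀` given the
  near-`1` clause of the RSW theorem at general `p` (`Nolin2008_lemma39_small`,
  `NearCriticalRSW.lean`, named fact `Nolin2008_RSW_one`), and — with no RSW input at all — above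
  Werner's easy-way length `L(p, η)`, `η ≤ 1/(100 e)` (`triLRCrossingProb_long_exp_le_charLengthW`,
  `WernerCorrelationLengthProofs.lean`: there the start of the block iteration is the definition
  of `L(p, η)`);
* "follows readily" is a theorem (`Nolin2008_lemma39_of_RSW_one_of_lengths`,
  `NearCriticalScalingProofs.lean`, with the equivalence of lengths as a hypothesis), and so is
  Cor. 37 from Kesten's relation `Nolin2008_prop34` and the two critical four-arm facts
  `Werner2009_fourArm_quasiMult`, `Werner2009_fourArm_lowerBound`
  (`charLength_le_mul_charLength_of_kesten_lt`, `CharLengthComparison.lean`; independently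
  `charLength_le_mul_charLength`, `CharLengthEquivalence.lean`, whence `Nolin2008_lemma39_of_prop34`
  there), together with the comparison of Werner's length with Nolin's, `L(p, η) ≤ C L_ε(p)` near
  `1/2` for every `ε ∈ (0, 1/2)`, which uses `Werner2009_kestenRelationW` in addition
  (`charLengthW_le_mul_charLength_of_kesten`, `CharLengthComparison.lean`).

## Contents (all proved)

* `Nolin2008_lemma39_of_leaves` — Nolin's route down to the current leaves:
  `Nolin2008_RSW_one → Werner2009_lemma62 → Werner2009_fourArm_quasiMult →
  Werner2009_fourArm_lowerBound → Nolin2008_lemma39` (Kesten's relation from the pivotal count,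
  `Nolin2008_prop34_of_expDecay`; Cor. 37 by `charLength_le_mul_charLength_of_kesten_lt`; the
  assembly `Nolin2008_lemma39_of_RSW_one_of_lengths`).
* Werner's route, which trades the RSW theorem at general `p` for the pivotal count of the
  `2n × n` parallelogram: `charLengthW_le_mul_charLength_of_near` (a comparison near `1/2` is a
  comparison on `(ε, 1/2)`); `Nolin2008_lemma39_of_kestenW : Nolin2008_prop34 →
  Werner2009_kestenRelationW → Werner2009_fourArm_quasiMult → Werner2009_fourArm_lowerBound →
  Nolin2008_lemma39`; `Nolin2008_cor41_of_kestenW` (the same four facts give `Nolin2008_cor41`,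
  through `Nolin2008_cor41_of_charLengthW_le`); and down to the leaves `Werner2009_lemma62`,
  `Werner2009_lemma62W` (`Werner2009_kestenRelationW_of_lemma62W`): `Nolin2008_lemma39_of_leavesW`,
  `Nolin2008_cor41_of_leavesW`, `Nolin2008_theta_asymp_of_leavesW`.

So the discharge `Nolin2008_lemma39_holds` waits on either of the two sets of named facts
`{Nolin2008_RSW_one, Werner2009_lemma62, Werner2009_fourArm_quasiMult, Werner2009_fourArm_lowerBound}`
or `{Werner2009_lemma62, Werner2009_lemma62W, Werner2009_fourArm_quasiMult,
Werner2009_fourArm_lowerBound}` — each a theory of its own (RSW at general `p`; the pivotal count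
below `L(p)`; near-critical arm separation and the five-arm exponent); nothing is restated here.

## References

* P. Nolin, Near-critical percolation in two dimensions, *Electron. J. Probab.* 13 (2008)
  1562–1623, §7.3 Cor. 37, §7.4 Lemma 39, Remark 40, Cor. 41, eq. (7.25) (arXiv 0711.4948:
  Cor. 35, Lemma 37, Remark 38, Cor. 39) [Nolin2008].
* W. Werner, Lectures on two-dimensional critical percolation, PCMI (2009), Lecture 6, §1,
  Lemma 6.2, Cor. 6.3 [WernerPCMI2009].
* H. Kesten, Scaling relations for 2D-percolation, *Comm. Math. Phys.* 109 (1987)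
  [KestenScalingCMP1987].

Tree: `Nolin2008_lemma39` (`NearCriticalArm.lean`), `Nolin2008_cor41` (`NearCriticalScaling.lean`),
`Nolin2008_theta_asymp` (`KestenScaling.lean`), `charLength_le_mul_charLength_of_kesten_lt`,
`charLengthW_le_mul_charLength_of_kesten` (`CharLengthComparison.lean`),
`Nolin2008_lemma39_of_RSW_one_of_lengths`, `Nolin2008_cor41_of_charLengthW_le`
(`NearCriticalScalingProofs.lean`),
`Nolin2008_theta_asymp_of_facts` (`KestenScalingThetaProofs.lean`),
`triLRCrossingProb_long_exp_le_charLengthW`, `one_le_charLengthW`, `charLengthW_antitone`,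
`Werner2009_kestenRelationW_of_lemma62W` (`WernerCorrelationLengthProofs.lean`), `charLengthW_symm`
(`WernerCorrelationLength.lean`), `one_le_charLength`, `Nolin2008_subcritical_crossing_holds`
(`NearCriticalRSW.lean`), `Nolin2008_prop34_of_expDecay` (`KestenRelationRussoProofs.lean`),
`BollobasRiordan2006_tri_expDecay_holds` (`TriSubcriticalCrossingProofs.lean`). Mathlib: `Real.exp`.
-/

noncomputable section

open MeasureTheory Set Filter Topology
open scoped unitInterval

namespace Literature.Probability.Percolation

open LatticeModels

/-! ### Nolin's route down to the leaves -/

/-- **Nolin's Lemma 39 [arXiv: Lemma 37] for every `ε ∈ (0, 1/2)` from its current leaves,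
Nolin's route**: the "moreover" clause of the Russo–Seymour–Welsh theorem (`Nolin2008_RSW_one`,
for the small-`ε` block argument), the pivotal count below `L(p)` (`Werner2009_lemma62`, giving
Kesten's relation `Nolin2008_prop34` by `Nolin2008_prop34_of_expDecay` and the theorem
`BollobasRiordan2006_tri_expDecay_holds`), and the two critical four-arm estimates
(`Werner2009_fourArm_quasiMult`, `Werner2009_fourArm_lowerBound`) for Cor. 37
(`charLength_le_mul_charLength_of_kesten_lt`) — assembled by
`Nolin2008_lemma39_of_RSW_one_of_lengths` (equivalently, `Nolin2008_lemma39_of_prop34` of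
`CharLengthEquivalence.lean` at `Nolin2008_prop34_of_expDecay _ h62`). [cite: Nolin2008, §7.4, Lemma 39 and Remark 40, with §7.3 Cor. 37 and Prop. 34 (arXiv 0711.4948: Lemma 37, Remark 38, Cor. 35, Prop. 32)] -/
theorem Nolin2008_lemma39_of_leaves (hone : Nolin2008_RSW_one) (h62 : Werner2009_lemma62)
    (hq : Werner2009_fourArm_quasiMult) (hl : Werner2009_fourArm_lowerBound) :
    Nolin2008_lemma39 :=
  have hK : Nolin2008_prop34 :=
    Nolin2008_prop34_of_expDecay BollobasRiordan2006_tri_expDecay_holds h62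
  Nolin2008_lemma39_of_RSW_one_of_lengths hone fun _ _ hε₀ hlt hε => by
    obtain ⟨δ, hδ, C, -, h⟩ := charLength_le_mul_charLength_of_kesten_lt hK hq hl hε₀ hlt.le hε
    exact ⟨δ, hδ, C, h⟩

/-! ### Werner's route: decay above `L(p, η)` and `L(p, η) ≤ C L_ε(p)` -/

/-- **A comparison of lengths near `1/2` is a comparison on `(ε, 1/2)`** (Werner's length against
Nolin's; cf. `charLength_le_mul_charLength_of_near`). If `charLengthW η p ≤ C · charLength ε p`
for `0 < |p - 1/2| < δ`, then `charLengthW η p ≤ K · charLength ε p` for all `ε < p < 1/2`: below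
`1/2 - δ`, `L(p, η) = L(1 - p, η) ≤ L(1/2 + min(δ, 1/4), η)` (`charLengthW_symm`,
`charLengthW_antitone`), while `L_ε(p) ≥ 1` (`one_le_charLength`). (Nolin's `≍` is uniform in `p`;
only `p → 1/2` carries content.) [cite: Nolin2008, §7.3, Cor. 37 and the Remark after it (arXiv 0711.4948: Cor. 35, Remark 36)] -/
theorem charLengthW_le_mul_charLength_of_near {η ε δ C : ℝ} (hη : 0 < η) (hε : 0 < ε)
    (hδ : 0 < δ)
    (hC : ∀ p : unitInterval, (p : ℝ) ≠ 1 / 2 → |(p : ℝ) - 1 / 2| < δ →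
      (charLengthW η p : ℝ) ≤ C * charLength ε p) :
    ∃ K > (0 : ℝ), ∀ p : unitInterval, ε < (p : ℝ) → (p : ℝ) < 1 / 2 →
      (charLengthW η p : ℝ) ≤ K * charLength ε p := by
  have hsub := Nolin2008_subcritical_crossing_holds
  -- the reference point `t₀ = 1/2 + min(δ, 1/4)` on the super-critical side
  have hδ₁0 : 0 < min δ (1 / 4) := lt_min hδ (by norm_num)
  have hδ₁δ : min δ (1 / 4) ≤ δ := min_le_left _ _
  have hδ₁4 : min δ (1 / 4) ≤ 1 / 4 := min_le_right _ _
  set t₀ : unitInterval := ⟨1 / 2 + min δ (1 / 4), by constructor <;> linarith⟩ with ht₀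
  have ht₀v : ((t₀ : unitInterval) : ℝ) = 1 / 2 + min δ (1 / 4) := rfl
  have ht₀h : 1 / 2 < ((t₀ : unitInterval) : ℝ) := by rw [ht₀v]; linarith
  set M : ℕ := charLengthW η t₀ with hM
  have hM1 : 1 ≤ M := one_le_charLengthW hη ht₀h.ne'
  have hM0 : (0 : ℝ) < M := by exact_mod_cast hM1
  refine ⟨max C (M : ℝ), lt_max_of_lt_right hM0, fun p hεp hp => ?_⟩
  have hL1 : (1 : ℝ) ≤ charLength ε p := by exact_mod_cast one_le_charLength hsub hε hεp hp
  have hL0 : (0 : ℝ) ≤ charLength ε p := by linarith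
  rcases lt_or_ge (1 / 2 - δ) (p : ℝ) with hnear | hfar
  · calc (charLengthW η p : ℝ) ≤ C * charLength ε p :=
          hC p hp.ne (by rw [abs_sub_lt_iff]; constructor <;> linarith)
      _ ≤ max C (M : ℝ) * charLength ε p := mul_le_mul_of_nonneg_right (le_max_left _ _) hL0
  · -- far from `1/2`: `L(p, η) = L(1 - p, η) ≤ L(t₀, η) = M ≤ M · L_ε(p)`
    have hσ : ((σ p : unitInterval) : ℝ) = 1 - p := unitInterval.coe_symm_eq p
    have ht₀p : t₀ ≤ σ p := Subtype.coe_le_coe.1 (by rw [ht₀v, hσ]; linarith)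
    have hmono : charLengthW η (σ p) ≤ M := charLengthW_antitone hη ht₀h ht₀p
    rw [charLengthW_symm] at hmono
    calc (charLengthW η p : ℝ) ≤ M := by exact_mod_cast hmono
      _ ≤ max C (M : ℝ) := le_max_right _ _
      _ = max C (M : ℝ) * 1 := (mul_one _).symm
      _ ≤ max C (M : ℝ) * charLength ε p :=
          mul_le_mul_of_nonneg_left hL1 (hM0.le.trans (le_max_right _ _))

/-- **Nolin's Lemma 39 for every `ε ∈ (0, 1/2)`, Werner's route** (Nolin 2008, Lemma 39 with
Remark 40; Werner 2009, Lecture 6, §1, second half of p. 43 for the decay above `L(p, η)`): with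
`η = min(η₁/2, 1/(100 e))`, the easy-way crossings decay above Werner's length,
`P_p(LR(n, k n)) ≤ 4k e^{1/4} e^{-n/(8 L(p, η))}` (`triLRCrossingProb_long_exp_le_charLengthW`, a
theorem), and `L(p, η) ≤ K L_ε(p)` on `(ε, 1/2)` (`charLengthW_le_mul_charLength_of_kesten`,
`charLengthW_le_mul_charLength_of_near`), whence `P_p(LR(n, k n)) ≤ 4k e^{1/4} e^{-n/(8 K L_ε(p))}`.
Inputs: `Nolin2008_prop34`, `Werner2009_kestenRelationW`, `Werner2009_fourArm_quasiMult`,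
`Werner2009_fourArm_lowerBound` — no RSW beyond `p = 1/2`. [cite: Nolin2008, §7.4, Lemma 39 and Remark 40 (arXiv 0711.4948: Lemma 37, Remark 38)] [cite: WernerPCMI2009, Lecture 6, §1] -/
theorem Nolin2008_lemma39_of_kestenW (hK : Nolin2008_prop34) (hKW : Werner2009_kestenRelationW)
    (hq : Werner2009_fourArm_quasiMult) (hl : Werner2009_fourArm_lowerBound) :
    Nolin2008_lemma39 := by
  obtain ⟨η₁, hη₁, hcmp⟩ := charLengthW_le_mul_charLength_of_kesten hK hKW hq hl
  have hη : 0 < min (η₁ / 2) (1 / (100 * Real.exp 1)) := lt_min (half_pos hη₁) (by positivity)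
  have hηη₁ : min (η₁ / 2) (1 / (100 * Real.exp 1)) < η₁ :=
    (min_le_left _ _).trans_lt (half_lt_self hη₁)
  have hη' : min (η₁ / 2) (1 / (100 * Real.exp 1)) ≤ 1 / (100 * Real.exp 1) := min_le_right _ _
  intro ε hε hε2 k hk
  obtain ⟨δ, hδ, C, -, hC⟩ := hcmp hη hηη₁ hε hε2
  obtain ⟨K, hK0, hKb⟩ := charLengthW_le_mul_charLength_of_near hη hε hδ hC
  refine ⟨4 * k * Real.exp (1 / 4), by positivity, 1 / (8 * K), by positivity,
    fun p hεp hp n hn => ?_⟩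
  have h := triLRCrossingProb_long_exp_le_charLengthW hη hη' hp hk hn
  refine h.trans (mul_le_mul_of_nonneg_left (Real.exp_le_exp.2 (neg_le_neg ?_)) (by positivity))
  have hW : (0 : ℝ) < charLengthW (min (η₁ / 2) (1 / (100 * Real.exp 1))) p := by
    exact_mod_cast one_le_charLengthW hη hp.ne
  have hcmpK := hKb p hεp hp
  calc 1 / (8 * K) * (n : ℝ) / charLength ε p = n / (8 * (K * charLength ε p)) := by
        rw [div_mul_eq_mul_div, one_mul, div_div, mul_assoc]
    _ ≤ n / (8 * charLengthW (min (η₁ / 2) (1 / (100 * Real.exp 1))) p) :=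
        div_le_div_of_nonneg_left (Nat.cast_nonneg n) (by positivity)
          (mul_le_mul_of_nonneg_left hcmpK (by norm_num))

/-- **Nolin's Cor. 41 for every `ε ∈ (0, 1/2)`, Werner's route**: `Nolin2008_cor41_of_charLengthW_le`
(decay above `L(1 - p, η)` and the ladder at base scale `L_ε(p)`) with its hypothesis
`L(p, η) ≤ C(ε) L_ε(p)` near `1/2` proved (`charLengthW_le_mul_charLength_of_kesten`,
`η = min(η₁/2, 1/(100 e))`). Inputs: `Nolin2008_prop34`, `Werner2009_kestenRelationW`,
`Werner2009_fourArm_quasiMult`, `Werner2009_fourArm_lowerBound`. [cite: Nolin2008, §7.4, Cor. 41 (arXiv 0711.4948: Cor. 39)] [cite: WernerPCMI2009, Lecture 6, §1 (last display)] -/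
theorem Nolin2008_cor41_of_kestenW (hK : Nolin2008_prop34) (hKW : Werner2009_kestenRelationW)
    (hq : Werner2009_fourArm_quasiMult) (hl : Werner2009_fourArm_lowerBound) :
    Nolin2008_cor41 := by
  obtain ⟨η₁, hη₁, hcmp⟩ := charLengthW_le_mul_charLength_of_kesten hK hKW hq hl
  have hη : 0 < min (η₁ / 2) (1 / (100 * Real.exp 1)) := lt_min (half_pos hη₁) (by positivity)
  have hηη₁ : min (η₁ / 2) (1 / (100 * Real.exp 1)) < η₁ :=
    (min_le_left _ _).trans_lt (half_lt_self hη₁)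
  refine Nolin2008_cor41_of_charLengthW_le hη (min_le_right _ _) fun ε hε hε2 => ?_
  obtain ⟨δ, hδ, C, -, hC⟩ := hcmp hη hηη₁ hε hε2
  exact ⟨δ, hδ, C, fun p hp1 hp2 =>
    hC p hp2.ne (by rw [abs_sub_lt_iff]; constructor <;> linarith)⟩

/-- **Nolin's Lemma 39 from its leaves, Werner's route**: as `Nolin2008_lemma39_of_kestenW` with
both Kesten relations replaced by the pivotal counts below `L(p)` — `Werner2009_lemma62` (rhombus,
`Nolin2008_prop34_of_expDecay`) and `Werner2009_lemma62W` (`2n × n` parallelogram,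
`Werner2009_kestenRelationW_of_lemma62W`). No RSW input at general `p`. [cite: Nolin2008, §7.4, Lemma 39 and Remark 40 (arXiv 0711.4948: Lemma 37, Remark 38)] [cite: WernerPCMI2009, Lecture 6, Lemma 6.2 and Cor. 6.3] -/
theorem Nolin2008_lemma39_of_leavesW (h62 : Werner2009_lemma62) (h62W : Werner2009_lemma62W)
    (hq : Werner2009_fourArm_quasiMult) (hl : Werner2009_fourArm_lowerBound) :
    Nolin2008_lemma39 :=
  Nolin2008_lemma39_of_kestenW
    (Nolin2008_prop34_of_expDecay BollobasRiordan2006_tri_expDecay_holds h62)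
    (Werner2009_kestenRelationW_of_lemma62W h62W) hq hl

/-- **Nolin's Cor. 41 from its leaves, Werner's route**: as `Nolin2008_cor41_of_kestenW` with the
two Kesten relations replaced by the pivotal counts `Werner2009_lemma62`, `Werner2009_lemma62W`. [cite: Nolin2008, §7.4, Cor. 41 (arXiv 0711.4948: Cor. 39)] [cite: WernerPCMI2009, Lecture 6, Lemma 6.2 and Cor. 6.3] -/
theorem Nolin2008_cor41_of_leavesW (h62 : Werner2009_lemma62) (h62W : Werner2009_lemma62W)
    (hq : Werner2009_fourArm_quasiMult) (hl : Werner2009_fourArm_lowerBound) :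
    Nolin2008_cor41 :=
  Nolin2008_cor41_of_kestenW
    (Nolin2008_prop34_of_expDecay BollobasRiordan2006_tri_expDecay_holds h62)
    (Werner2009_kestenRelationW_of_lemma62W h62W) hq hl

/-- **`θ(p) ≍ π₁(L_ε(p))` for every `ε ∈ (0, 1/2)` from named facts, Werner's route** (Nolin 2008,
§7.4, eq. (7.25)): the five near-critical arm estimates of `Nolin2008_theta_asymp_of_facts`
(`KestenScalingThetaProofs.lean`) and the two pivotal counts `Werner2009_lemma62`,
`Werner2009_lemma62W` — no RSW clause at general `p` (cf. `Nolin2008_theta_asymp_of_lemma62`,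
`CharLengthEquivalence.lean`, which uses `Nolin2008_RSW_one` instead of `Werner2009_lemma62W`);
`Nolin2008_theta_asymp_of_facts` with `Nolin2008_cor41_of_leavesW`. [cite: Nolin2008, §7.4, eq. (7.25) (arXiv 0711.4948: display after Cor. 39)] -/
theorem Nolin2008_theta_asymp_of_leavesW (hq : Werner2009_fourArm_quasiMult)
    (hl : Werner2009_fourArm_lowerBound) (hHP : Nolin2008_halfPlane_twoArm)
    (hHP' : Werner2009_halfPlane_twoArm) (hP : Werner2009_pivotal_lowerBound)
    (h62 : Werner2009_lemma62) (h62W : Werner2009_lemma62W) : Nolin2008_theta_asymp :=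
  Nolin2008_theta_asymp_of_facts hq hl hHP hHP' hP (Nolin2008_cor41_of_leavesW h62 h62W hq hl)

end Literature.Probability.Percolation
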